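import Mathlib
import Summits.Ventures.HodgeRepro.Tier4.Line1.RTFSetting
import Summits.Ventures.HodgeRepro.Tier4.Line1.InnerCalculus
import Summits.Ventures.HodgeRepro.Tier4.Line1.InnerBridge
import Summits.Ventures.HodgeRepro.Tier4.Line1.OrthComplement
import Summits.Ventures.HodgeRepro.Tier4.Line1.MaximalFamily

/-!
# Tier4/Line4/MaximalFamilyClosed — maximal orthogonal families of CLOSED irreducible invariant subspaces

Blind re-derivation cell `pub-hodge-repro`, Tier 4 «prove the step» (README §9–§10), seat t4-L4-p1 (prover, LINE L4,
gen 3; candidate finding F-L4-DENSE S13894).  Tree path `lean/Summits/Ventures/HodgeRepro/Tier4/Line4/MaximalFamilyClosed.lean`.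
Mathlib-level; no literature.  Generic over any `S : RTF.Setting G`.

WHAT IS PROVED.  `IsClosedSub S U` — the (4b) closedness clause as a predicate (every continuous invariant `L²(D_G)`-limit
of members is a member); `IsOrthFamilyC` — t4-L4-p1 g0's `IsOrthFamily` (`Line1/MaximalFamily`) with every member
CLOSED; Zorn above a given closed family (`exists_maximal_orthFamilyC_extending`, `exists_maximal_orthFamilyC`); and
the spanning property of a maximal closed family (`ae_eq_zero_of_orth_maximalC`) from the CLOSED form of rung (4b)
(`h4bC`, the shape of `Line4/IrreducibleSubspaceClosed`): g0's proof verbatim with the closed (4b).  Also: `{0}` is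
closed (`isClosedSub_zero`), and the conjugate image of a closed subspace is closed (`isClosedSub_conj`).

HC_CM is NOT proved by anyone in this repository.
-/

set_option autoImplicit false

noncomputable section

namespace Summit.Ventures.HodgeRepro.Tier4.Line4

open Summit.Ventures.HodgeRepro.Tier4.Line1 MeasureTheory Topology
open scoped ComplexConjugate InnerProductSpace

variable {G : Type} [Group G] [TopologicalSpace G] [IsTopologicalGroup G] [MeasurableSpace G]
  [BorelSpace G]

variable (S : RTF.Setting G)

section Closed

omit [IsTopologicalGroup G] [BorelSpace G] in
/-- **Closedness** (the (4b) clause): every continuous invariant function that is an `L²(D_G)`-limit of members of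
`U` is a member. -/
def IsClosedSub (U : Set (G → ℂ)) : Prop :=
  ∀ ψ : G → ℂ, Continuous ψ → S.Invariant ψ →
    (∀ ε : ℝ, 0 < ε → ∃ ψ' ∈ U, eLpNorm (fun x => ψ x - ψ' x) 2 (S.μ.restrict S.DG) < ENNReal.ofReal ε) →
    ψ ∈ U

/-- The zero subspace is closed. -/
theorem isClosedSub_zero [SecondCountableTopology G] : IsClosedSub S ({0} : Set (G → ℂ)) := by
  haveI : Countable S.Gk := S.countable_Gk
  intro ψ hc hinv happ
  rw [Set.mem_singleton_iff]
  -- `ψ` is an `L²`-limit of `0`, hence a.e. zero, hence zero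
  have h0 : ψ =ᵐ[S.μ.restrict S.DG] 0 := by
    have hψL : MemLp ψ 2 (S.μ.restrict S.DG) := S.memLp_restrict_of_continuous hc
    have hnorm : eLpNorm ψ 2 (S.μ.restrict S.DG) = 0 := by
      apply le_antisymm _ bot_le
      apply ENNReal.le_of_forall_pos_le_add
      intro ε hε _
      obtain ⟨ψ', hψ', hlt⟩ := happ ε (by exact_mod_cast hε)
      rw [Set.mem_singleton_iff] at hψ'
      subst hψ'
      simp only [Pi.zero_apply, sub_zero] at hlt
      rw [bot_eq_zero, zero_add]
      have : ENNReal.ofReal (ε : ℝ) = (ε : ENNReal) := ENNReal.ofReal_coe_nnreal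
      rw [this] at hlt
      exact le_of_lt hlt
    exact (eLpNorm_eq_zero_iff hψL.1 (by norm_num)).1 hnorm
  exact S.eq_of_ae_eq_DG hinv hc (fun _ _ => rfl) continuous_const h0

/-- A family of non-zero irreducible invariant subspaces, pairwise orthogonal, every member CLOSED. -/
def IsOrthFamilyC (F : Set (Set (G → ℂ))) : Prop :=
  (∀ V ∈ F, S.IsIrrNonzero V ∧ IsClosedSub S V) ∧
    ∀ V ∈ F, ∀ V' ∈ F, V ≠ V' → ∀ ψ ∈ V, ∀ ψ' ∈ V', S.inner ψ ψ' = 0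

omit [IsTopologicalGroup G] [BorelSpace G] in
/-- A closed orthogonal family is an orthogonal family. -/
theorem isOrthFamily_of_isOrthFamilyC {F : Set (Set (G → ℂ))} (hF : IsOrthFamilyC S F) : S.IsOrthFamily F :=
  ⟨fun V hV => (hF.1 V hV).1, hF.2⟩

omit [IsTopologicalGroup G] [BorelSpace G] in
/-- The union of a chain of closed orthogonal families is a closed orthogonal family. -/
theorem isOrthFamilyC_sUnion {c : Set (Set (Set (G → ℂ)))} (hc : IsChain (· ⊆ ·) c)
    (hF : ∀ F ∈ c, IsOrthFamilyC S F) : IsOrthFamilyC S (⋃₀ c) := by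
  refine ⟨fun V hV => ?_, fun V hV V' hV' hne ψ hψ ψ' hψ' => ?_⟩
  · obtain ⟨F, hFc, hVF⟩ := Set.mem_sUnion.1 hV
    exact (hF F hFc).1 V hVF
  · obtain ⟨F, hFc, hVF⟩ := Set.mem_sUnion.1 hV
    obtain ⟨F', hF'c, hV'F'⟩ := Set.mem_sUnion.1 hV'
    rcases hc.total hFc hF'c with h | h
    · exact (hF F' hF'c).2 V (h hVF) V' hV'F' hne ψ hψ ψ' hψ'
    · exact (hF F hFc).2 V hVF V' (h hV'F') hne ψ hψ ψ' hψ'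

omit [IsTopologicalGroup G] [BorelSpace G] in
/-- **Zorn above a given closed family**. -/
theorem exists_maximal_orthFamilyC_extending {F₀ : Set (Set (G → ℂ))} (hF₀ : IsOrthFamilyC S F₀) :
    ∃ F : Set (Set (G → ℂ)), IsOrthFamilyC S F ∧ F₀ ⊆ F ∧
      ∀ F', IsOrthFamilyC S F' → F ⊆ F' → F' = F := by
  obtain ⟨F, hsub, hmax⟩ := zorn_subset_nonempty {F : Set (Set (G → ℂ)) | IsOrthFamilyC S F}
    (fun c hc hchain _ => ⟨⋃₀ c, isOrthFamilyC_sUnion S hchain (fun F hF => hc hF),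
      fun F hF => Set.subset_sUnion_of_mem hF⟩) F₀ hF₀
  exact ⟨F, hmax.prop, hsub, fun F' hF' hle => (hmax.eq_of_subset hF' hle).symm⟩

omit [IsTopologicalGroup G] [BorelSpace G] in
/-- **Zorn**: there is a maximal closed orthogonal family. -/
theorem exists_maximal_orthFamilyC :
    ∃ F : Set (Set (G → ℂ)), IsOrthFamilyC S F ∧ ∀ F', IsOrthFamilyC S F' → F ⊆ F' → F' = F := by
  obtain ⟨F, hF, -, hmax⟩ := exists_maximal_orthFamilyC_extending S
    (F₀ := ∅) ⟨fun V hV => absurd hV (by simp), fun V hV => absurd hV (by simp)⟩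
  exact ⟨F, hF, hmax⟩

/-- **A maximal closed orthogonal family spans**, given the CLOSED form of rung (4b): every `ψ₀ ∈ L²(DG)` orthogonal
to all its members is a.e. zero (g0's `ae_eq_zero_of_orth_maximal` with the closed (4b)). -/
theorem ae_eq_zero_of_orth_maximalC [LocallyCompactSpace G] [SecondCountableTopology G]
    (h4bC : ∀ V : Set (G → ℂ), S.IsInvariantSubspace V →
      (∀ ψ : G → ℂ, Continuous ψ → S.Invariant ψ →
        (∀ ε : ℝ, 0 < ε → ∃ ψ' ∈ V,
          eLpNorm (fun x => ψ x - ψ' x) 2 (S.μ.restrict S.DG) < ENNReal.ofReal ε) → ψ ∈ V) →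
      (∃ ψ ∈ V, ∃ x, ψ x ≠ 0) →
      ∃ V' : Set (G → ℂ), S.IsInvariantSubspace V' ∧ V' ⊆ V ∧ S.IsIrreducible V' ∧
        (∃ ψ ∈ V', ∃ x, ψ x ≠ 0) ∧ IsClosedSub S V')
    {F : Set (Set (G → ℂ))} (hF : IsOrthFamilyC S F) (hmax : ∀ F', IsOrthFamilyC S F' → F ⊆ F' → F' = F)
    {ψ₀ : G → ℂ} (hψ₀ : MemLp ψ₀ 2 (S.μ.restrict S.DG)) (horth : ∀ V ∈ F, ∀ w ∈ V, S.inner ψ₀ w = 0) :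
    ψ₀ =ᵐ[S.μ.restrict S.DG] 0 := by
  haveI : Countable S.Gk := S.countable_Gk
  by_contra hne
  have hFinv : ∀ V ∈ F, S.IsInvariantSubspace V := fun V hV => (hF.1 V hV).1.1
  obtain ⟨ψ, hψ, hψne⟩ := S.exists_mem_orthSet_ne_zero hFinv hψ₀ hne horth
  obtain ⟨V', hV'inv, hV'sub, hV'irr, hV'ne, hV'cl⟩ := h4bC (S.orthSet F) (S.orthSet_isInvariantSubspace hFinv)
    (S.orthSet_relClosed hFinv) ⟨ψ, hψ, hψne⟩
  have horthV' : ∀ V ∈ F, ∀ w ∈ V, ∀ ψ' ∈ V', S.inner w ψ' = 0 ∧ S.inner ψ' w = 0 := by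
    intro V hV w hw ψ' hψ'
    have h1 : S.inner ψ' w = 0 := (hV'sub hψ').2.2 V hV w hw
    refine ⟨?_, h1⟩
    rw [S.inner_conj (S.memLp_restrict_of_continuous (hV'sub hψ').1)
      (S.memLp_restrict_of_continuous ((hFinv V hV).cont w hw)), h1, map_zero]
  have hV'notmem : V' ∉ F := by
    intro hmem
    obtain ⟨ψ', hψ', x, hx⟩ := hV'ne
    have h0 : S.inner ψ' ψ' = 0 := (hV'sub hψ').2.2 V' hmem ψ' hψ'
    have := S.eq_zero_of_inner_self_eq_zero (hV'sub hψ').2.1 (hV'sub hψ').1 h0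
    exact hx (by rw [this]; rfl)
  have hF' : IsOrthFamilyC S (insert V' F) := by
    refine ⟨fun V hV => ?_, fun V hV W hW hne' ψ hψ φ hφ => ?_⟩
    · rcases Set.mem_insert_iff.1 hV with rfl | hV
      · exact ⟨⟨hV'inv, hV'irr, hV'ne⟩, hV'cl⟩
      · exact hF.1 V hV
    · rcases Set.mem_insert_iff.1 hV with hVe | hVF <;> rcases Set.mem_insert_iff.1 hW with hWe | hWF
      · exact absurd (hVe.trans hWe.symm) hne'
      · rw [hVe] at hψ
        exact (horthV' W hWF φ hφ ψ hψ).2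
      · rw [hWe] at hφ
        exact (horthV' V hVF ψ hψ φ hφ).1
      · exact hF.2 V hVF W hWF hne' ψ hψ φ hφ
  have := hmax _ hF' (Set.subset_insert V' F)
  exact hV'notmem (this ▸ Set.mem_insert V' F)

omit [IsTopologicalGroup G] [BorelSpace G] in
/-- The conjugate image of a closed subspace is closed. -/
theorem isClosedSub_conj {U : Set (G → ℂ)} (hU : IsClosedSub S U) :
    IsClosedSub S ((fun ψ : G → ℂ => fun x => conj (ψ x)) '' U) := by
  intro ψ hc hinv happ
  refine ⟨fun x => conj (ψ x), hU _ (Complex.continuous_conj.comp hc) (fun γ x => by simp only [hinv γ x])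
    fun ε hε => ?_, ?_⟩
  · obtain ⟨_, ⟨ψ', hψ', rfl⟩, hlt⟩ := happ ε hε
    refine ⟨ψ', hψ', ?_⟩
    have e : (fun x => conj (ψ x) - ψ' x) = fun x => conj (ψ x) - conj (conj (ψ' x)) := by
      funext x
      simp only [Complex.conj_conj]
    rw [e]
    have e2 : eLpNorm (fun x => conj (ψ x) - conj (conj (ψ' x))) 2 (S.μ.restrict S.DG) =
        eLpNorm (fun x => ψ x - conj (ψ' x)) 2 (S.μ.restrict S.DG) := by
      apply eLpNorm_congr_norm_ae
      refine Filter.Eventually.of_forall fun x => ?_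
      rw [← map_sub, RCLike.norm_conj]
    rw [e2]
    exact hlt
  · funext x
    simp only [Complex.conj_conj]

end Closed

end Summit.Ventures.HodgeRepro.Tier4.Line4

end
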